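import Literature.Geometry.Lorentzian.ChartSecondFundamentalFormDilation
import HarnessLib

/-!
# Translation invariance of the induced data on chart domains with translation-invariant components

Let `g` be a metric on a chart domain `V ⊆ E` whose components `G` (`g.val x = G x`) are INVARIANT under the
translation by a fixed vector `w`: `G (x + w) = G x` for all `x` — the model case is a stationary metric in
coordinates adapted to the Killing field, e.g. the Kerr–Schild components `Kerr.bilin M a` under
`x ↦ x + t ∂_{t*}` (`Kerr.bilin_add_smul_basisVector_zero`, `KerrSchildCoord.lean`). Let `f, f' : U → V` be maps
from a chart domain `U ⊆ E'` with `f' y = f y + w` (the translate of the parametrised hypersurface `f`), and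
`ν, ν'` fields along `f, f'` with THE SAME values (`ν' y = ν y ∈ E`). Then at every point where the data are
differentiable:

* `OpensChart.mfderiv_translate_apply`, `mdifferentiableAt_translate`, `contMDiffAt_translate` — `df' = df`;
* `OpensChart.christoffel_eq_of_add_eq` — the Christoffel map at `x + w` equals that at `x` (the Koszul form is
  built from `∂G`, and `∂G(x + w) = ∂G(x)`; index raising only sees `g_x = g_{x+w}`);
* `OpensChart.pullbackBilin_translate` — `f'^* g = f^* g` pointwise; hence
  `isSpacelikeImmersion_translate`, `isNormalTo_translate`, `isUnitNormal_translate`, and, for a Lorentzian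
  metric whose time-orientation field is also translation invariant, `isFutureUnitNormal_translate`;
* `OpensChart.secondFundamentalForm_translate` — **`K_{ν'}(f') = K_{ν}(f)`** at every point where `f`, a
  representative of `ν` and `G` are differentiable (the coordinate formula
  `K = g(DN v + Γ(N)(DΦ v), DΦ w)`, `OpensChart.secondFundamentalForm_eq_of_repr`, is literal in these data).

This is the extrinsic-geometry content of "a one-parameter group of isometries carries a hypersurface to an
isometric one with the corresponding unit normal and the same second fundamental form" (O'Neill 1983, Ch. 3,
Prop. 3.59 and Cor. 3.61; Ch. 4, pp. 104–107; Ch. 9, pp. 255–256 for Killing fields), in the concrete form the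
explicit Kruskal slicings of the `FinalStateConjecture` routes consume: the induced data of a `t*`-translated
Kerr–Schild leaf, cylinder or bent slice coincide with those of the original.

Everything is proved; no definitions, no named facts.

## References

* B. O'Neill, *Semi-Riemannian geometry with applications to relativity* (1983), Ch. 3, Prop. 3.13,
  Prop. 3.59, Cor. 3.61; Ch. 4, Lemma 4.1, Lemma 4.4, pp. 104–107; Ch. 9, pp. 255–256. [`ONeill1983`]
-/

noncomputable section

-- instance search through the nested operator type `E →L[ℝ] E →L[ℝ] ℝ` (as in the tree files)
set_option maxSynthPendingDepth 3

open Bundle Set Function Filter Manifold TopologicalSpace Module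
open scoped Manifold ContDiff Topology

namespace Literature.Geometry.Lorentzian

namespace OpensChart

variable {E : Type*} [NormedAddCommGroup E] [NormedSpace ℝ E] [FiniteDimensional ℝ E]
  {E' : Type*} [NormedAddCommGroup E'] [NormedSpace ℝ E']
  {V : Opens E} {U : Opens E'}

/-! ### Calculus of translation-invariant components -/

section Components

variable {F : Type*} [NormedAddCommGroup F] [NormedSpace ℝ F] {G : E → F} {w : E}

omit [FiniteDimensional ℝ E] in
/-- A translation-invariant function has translation-invariant derivative: `DG(x + w) = DG(x)`.
[folklore] -/
theorem fderiv_eq_of_forall_add_eq (hGw : ∀ x, G (x + w) = G x) (x : E) :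
    fderiv ℝ G (x + w) = fderiv ℝ G x := by
  rw [← fderiv_comp_add_right w, show (fun x ↦ G (x + w)) = G from funext hGw]

omit [FiniteDimensional ℝ E] in
/-- Differentiability of a translation-invariant function is translation invariant. [folklore] -/
theorem differentiableAt_iff_of_forall_add_eq (hGw : ∀ x, G (x + w) = G x) (x : E) :
    DifferentiableAt ℝ G (x + w) ↔ DifferentiableAt ℝ G x := by
  rw [← differentiableAt_comp_add_right w, show (fun x ↦ G (x + w)) = G from funext hGw]

end Components

variable {n : ℕ∞ω} {g : PseudoRiemannianMetric 𝓘(ℝ, E) n E (TangentSpace 𝓘(ℝ, E) : V → Type _)}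
  {G : E → E →L[ℝ] E →L[ℝ] ℝ} {w : E}

omit [FiniteDimensional ℝ E] in
/-- The Koszul form of translation-invariant components is translation invariant. [folklore] -/
theorem koszulForm_eq_of_forall_add_eq (hGw : ∀ x, G (x + w) = G x) (x Y₀ : E) :
    koszulForm G (x + w) Y₀ = koszulForm G x Y₀ := by
  refine LinearMap.ext₂ fun X₀ Z₀ ↦ ?_
  simp only [koszulForm_apply, fderiv_eq_of_forall_add_eq hGw x]

/-- **The Christoffel map of translation-invariant components is translation invariant**: for
`x, x' ∈ V` with `x' = x + w`, `Γ_{x'} = Γ_{x}` (the Koszul forms agree, and index raising only sees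
`g_{x'} = G(x + w) = G(x) = g_x`). O'Neill 1983, Ch. 3, Prop. 3.13. [cite: ONeill1983, Ch. 3, Prop. 3.13] -/
theorem christoffel_eq_of_add_eq (hG : ∀ x : V, g.val x = G x) (hGw : ∀ x, G (x + w) = G x)
    {x x' : V} (hx : (x' : E) = x + w) (Y₀ X₀ : E) :
    (christoffel g G x' Y₀ X₀ : E) = christoffel g G x Y₀ X₀ := by
  have hval : (g.val x' : E →L[ℝ] E →L[ℝ] ℝ) = (g.val x : E →L[ℝ] E →L[ℝ] ℝ) := by
    rw [hG, hG, hx, hGw]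
  rw [christoffel_apply, christoffel_apply, hx, koszulForm_eq_of_forall_add_eq hGw,
    sharp_eq_of_val_eq (g := g) (g' := g) hval]

/-! ### The translate of a map between chart domains -/

section Translate

variable {f f' : U → V} (hf' : ∀ y, (f' y : E) = f y + w)
include hf'

omit [FiniteDimensional ℝ E] in
/-- **The differentials of a map and of its translate agree**: `df'_y = df_y` for `f` differentiable at
`y`. [folklore] -/
theorem mfderiv_translate_apply {y : U} (hfd : MDifferentiableAt 𝓘(ℝ, E') 𝓘(ℝ, E) f y) (v : E') :
    mfderiv 𝓘(ℝ, E') 𝓘(ℝ, E) f' y v = mfderiv 𝓘(ℝ, E') 𝓘(ℝ, E) f y v := by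
  obtain ⟨Φ, hΦ⟩ := exists_repr f
  have hΦd : DifferentiableAt ℝ Φ y := differentiableAt_of_repr hΦ hfd
  have hrep : ∀ z : U, (f' z : E) = (fun z : E' ↦ Φ z + w) z := fun z ↦ by simp only [hf', hΦ]
  rw [mfderiv_apply_of_repr hrep (hΦd.add_const w), mfderiv_apply_of_repr hΦ hΦd, fderiv_add_const]

omit [FiniteDimensional ℝ E] in
/-- The translate is differentiable where the map is. [folklore] -/
theorem mdifferentiableAt_translate {y : U} (hfd : MDifferentiableAt 𝓘(ℝ, E') 𝓘(ℝ, E) f y) :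
    MDifferentiableAt 𝓘(ℝ, E') 𝓘(ℝ, E) f' y := by
  obtain ⟨Φ, hΦ⟩ := exists_repr f
  have hΦd : DifferentiableAt ℝ Φ y := differentiableAt_of_repr hΦ hfd
  have hrep : ∀ z : U, (f' z : E) = (fun z : E' ↦ Φ z + w) z := fun z ↦ by simp only [hf', hΦ]
  exact mdifferentiableAt_of_repr hrep (hΦd.add_const w)

omit [FiniteDimensional ℝ E] in
/-- The translate is `C^m` where the map is. [folklore] -/
theorem contMDiffAt_translate {m : WithTop ℕ∞} {y : U} (hfd : ContMDiffAt 𝓘(ℝ, E') 𝓘(ℝ, E) m f y) :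
    ContMDiffAt 𝓘(ℝ, E') 𝓘(ℝ, E) m f' y := by
  obtain ⟨Φ, hΦ⟩ := exists_repr f
  have hval : ContMDiffAt 𝓘(ℝ, E) 𝓘(ℝ, E) m (Subtype.val : V → E) (f y) :=
    contMDiff_subtype_val (f y)
  have h1 : ContMDiffAt 𝓘(ℝ, E') 𝓘(ℝ, E) m (Subtype.val ∘ f) y := hval.comp y hfd
  have hΦs : ContDiffAt ℝ m Φ y := (contMDiffAt_iff y (Subtype.val ∘ f) Φ hΦ).1 h1
  have hrep : ∀ z : U, (Subtype.val ∘ f') z = (fun z : E' ↦ Φ z + w) z := fun z ↦ by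
    simp only [comp_apply, hf', hΦ]
  have h2 : ContMDiffAt 𝓘(ℝ, E') 𝓘(ℝ, E) m (Subtype.val ∘ f') y :=
    (contMDiffAt_iff y (Subtype.val ∘ f') _ hrep).2 (hΦs.add contDiffAt_const)
  exact (ChartedSpace.liftPropWithinAt_subtypeVal_comp_iff f' univ y).mp h2

omit [FiniteDimensional ℝ E] in
/-- The translate is `C^m` if the map is. [folklore] -/
theorem contMDiff_translate {m : WithTop ℕ∞} (hfd : ContMDiff 𝓘(ℝ, E') 𝓘(ℝ, E) m f) :
    ContMDiff 𝓘(ℝ, E') 𝓘(ℝ, E) m f' := fun y ↦ contMDiffAt_translate hf' (hfd y)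

variable (hG : ∀ x : V, g.val x = G x) (hGw : ∀ x, G (x + w) = G x)
include hG hGw

omit [FiniteDimensional ℝ E] [NormedSpace ℝ E'] in
/-- The metric at the translated base point equals the metric at the base point. [folklore] -/
theorem val_translate_eq (y : U) : (g.val (f' y) : E →L[ℝ] E →L[ℝ] ℝ) = g.val (f y) := by
  rw [hG, hG, hf', hGw]

omit [FiniteDimensional ℝ E] in
/-- **The induced forms of a map and of its translate agree**: `(f'^* g)_y = (f^* g)_y` for `f`
differentiable at `y`. O'Neill 1983, Ch. 3, p. 58 with Prop. 3.59. [cite: ONeill1983, Ch. 3, Prop. 3.59] -/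
theorem pullbackBilin_translate {y : U} (hfd : MDifferentiableAt 𝓘(ℝ, E') 𝓘(ℝ, E) f y) :
    pullbackBilin (I := 𝓘(ℝ, E)) (I' := 𝓘(ℝ, E')) f' g.val y =
      pullbackBilin (I := 𝓘(ℝ, E)) (I' := 𝓘(ℝ, E')) f g.val y := by
  ext v v'
  rw [pullbackBilin_apply, pullbackBilin_apply, mfderiv_translate_apply hf' hfd,
    mfderiv_translate_apply hf' hfd]
  exact congrFun (congrArg DFunLike.coe (congrFun (congrArg DFunLike.coe (val_translate_eq hf' hG hGw y)) _)) _

omit [FiniteDimensional ℝ E] in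
/-- **The translate of a spacelike immersion is a spacelike immersion.** [cite: ONeill1983, Ch. 3, Prop. 3.59] -/
theorem isSpacelikeImmersion_translate (hsp : g.IsSpacelikeImmersion 𝓘(ℝ, E') f) :
    g.IsSpacelikeImmersion 𝓘(ℝ, E') f' := by
  refine ⟨contMDiff_translate hf' hsp.1, fun y v hv ↦ ?_⟩
  have hfd : MDifferentiableAt 𝓘(ℝ, E') 𝓘(ℝ, E) f y := (hsp.1 y).mdifferentiableAt (by simp)
  have h := hsp.2 y v hv
  rw [PseudoRiemannianMetric.inducedBilin] at h ⊢
  rw [pullbackBilin_translate hf' hG hGw hfd]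
  exact h

omit [FiniteDimensional ℝ E] in
/-- **A normal field keeps its values under translation**: if `ν` is normal to `f` then the field with the
same values is normal to the translate `f'` (stated for `f` differentiable everywhere on `U`).
[cite: ONeill1983, Ch. 4, pp. 104–107] -/
theorem isNormalTo_translate {ν : NormalField 𝓘(ℝ, E) f} {ν' : NormalField 𝓘(ℝ, E) f'}
    (hν' : ∀ y, (ν' y : E) = ν y) (hfd : ∀ y, MDifferentiableAt 𝓘(ℝ, E') 𝓘(ℝ, E) f y)
    (hn : g.IsNormalTo 𝓘(ℝ, E') f ν) : g.IsNormalTo 𝓘(ℝ, E') f' ν' := by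
  intro y v
  have h := hn y v
  have hval := val_translate_eq hf' hG hGw y
  rw [show (g.val (f' y) (ν' y) (mfderiv 𝓘(ℝ, E') 𝓘(ℝ, E) f' y v) : ℝ) =
      (g.val (f y) : E →L[ℝ] E →L[ℝ] ℝ) (ν y) (mfderiv 𝓘(ℝ, E') 𝓘(ℝ, E) f y v) by
    rw [← hval, mfderiv_translate_apply hf' (hfd y), hν']; rfl]
  exact h

omit [FiniteDimensional ℝ E] in
/-- **A unit normal keeps its values under translation.** [cite: ONeill1983, Ch. 4, pp. 104–107] -/
theorem isUnitNormal_translate {ν : NormalField 𝓘(ℝ, E) f} {ν' : NormalField 𝓘(ℝ, E) f'}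
    (hν' : ∀ y, (ν' y : E) = ν y) (hfd : ∀ y, MDifferentiableAt 𝓘(ℝ, E') 𝓘(ℝ, E) f y) {ε : ℝ}
    (hun : g.IsUnitNormal 𝓘(ℝ, E') f ν ε) : g.IsUnitNormal 𝓘(ℝ, E') f' ν' ε := by
  refine ⟨isNormalTo_translate hf' hG hGw hν' hfd hun.1, fun y ↦ ?_⟩
  have h := hun.2 y
  have hval := val_translate_eq hf' hG hGw y
  rw [show (g.val (f' y) (ν' y) (ν' y) : ℝ) = (g.val (f y) : E →L[ℝ] E →L[ℝ] ℝ) (ν y) (ν y) by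
    rw [← hval, hν']; rfl]
  exact h

end Translate

/-! ### Future unit normals of a time-oriented Lorentzian metric -/

section Future

variable {gL : LorentzianMetric 𝓘(ℝ, E) n V} {τ : TimeOrientation gL} {f f' : U → V}
  (hf' : ∀ y, (f' y : E) = f y + w) (hG : ∀ x : V, gL.val x = G x) (hGw : ∀ x, G (x + w) = G x)
  (hτ : ∀ x x' : V, (x' : E) = x + w → (τ.vectorField x' : E) = τ.vectorField x)
include hf' hG hGw hτ

omit [FiniteDimensional ℝ E] in
/-- **A future unit normal keeps its values under translation**, for a time orientation whose vector field
is itself translation invariant (`τ(x + w) = τ(x)`, e.g. the Kerr–Schild time-orientation field). O'Neill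
1983, Ch. 5, p. 145 with Ch. 3, Prop. 3.59. [cite: ONeill1983, Ch. 3, Prop. 3.59] -/
theorem isFutureUnitNormal_translate {ν : NormalField 𝓘(ℝ, E) f} {ν' : NormalField 𝓘(ℝ, E) f'}
    (hν' : ∀ y, (ν' y : E) = ν y) (hfd : ∀ y, MDifferentiableAt 𝓘(ℝ, E') 𝓘(ℝ, E) f y)
    (hfun : gL.IsFutureUnitNormal 𝓘(ℝ, E') τ f ν) : gL.IsFutureUnitNormal 𝓘(ℝ, E') τ f' ν' := by
  refine ⟨isUnitNormal_translate (g := gL.toPseudoRiemannianMetric) hf' hG hGw hν' hfd hfun.1, fun y ↦ ?_⟩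
  have h := hfun.2 y
  have hval : (gL.val (f' y) : E →L[ℝ] E →L[ℝ] ℝ) = gL.val (f y) :=
    val_translate_eq (g := gL.toPseudoRiemannianMetric) hf' hG hGw y
  have hτy : (τ.vectorField (f' y) : E) = τ.vectorField (f y) := hτ (f y) (f' y) (hf' y)
  -- unfold future-directedness: causal + `g(τ, ν) < 0`, all read through `hval`, `hν'`, `hτy`
  simp only [TimeOrientation.IsFutureDirected, LorentzianMetric.IsCausal] at h ⊢
  refine ⟨⟨?_, ?_⟩, ?_⟩
  · have := h.1.1
    rw [show (gL.val (f' y) (ν' y) (ν' y) : ℝ) = (gL.val (f y) : E →L[ℝ] E →L[ℝ] ℝ) (ν y) (ν y) by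
      rw [← hval, hν']; rfl]
    exact this
  · have := h.1.2
    rw [show (ν' y : E) = ν y from hν' y]
    exact this
  · have := h.2
    rw [show (gL.val (f' y) (τ.vectorField (f' y)) (ν' y) : ℝ) =
        (gL.val (f y) : E →L[ℝ] E →L[ℝ] ℝ) (τ.vectorField (f y)) (ν y) by
      rw [← hval, hν', ← hτy]; rfl]
    exact this

end Future

/-! ### The second fundamental form -/

section SecondFundamentalForm

variable [g.HasLeviCivita] [FiniteDimensional ℝ E'] {f f' : U → V}
  (hf' : ∀ y, (f' y : E) = f y + w) (hG : ∀ x : V, g.val x = G x) (hGw : ∀ x, G (x + w) = G x)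
include hf' hG hGw

/-- **Translation invariance of the second fundamental form.** Let the components `G` of `g` be invariant
under `x ↦ x + w`, let `f' = f + w` be the translate of `f : U → V`, and let `ν, ν'` be fields along `f, f'`
with a common representative `N` (`ν y = N y = ν' y` on `U`). At a point `y` where a representative
`Φ` of `f`, the representative `N` and the components `G` (at `f y`) are differentiable,
`K_{ν'}(f')_y = K_{ν}(f)_y` as bilinear forms on `E'`: in the coordinate formula
`K(v, v') = g_{f y}(DN(y) v + Γ_{f y}(N y)(DΦ(y) v), DΦ(y) v')` (`secondFundamentalForm_eq_of_repr`) every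
ingredient is unchanged (`D(Φ + w) = DΦ`, `g_{f y + w} = g_{f y}`, `Γ_{f y + w} = Γ_{f y}`). O'Neill 1983,
Ch. 4, Lemma 4.4 with Ch. 3, Prop. 3.59 / Cor. 3.61. [cite: ONeill1983, Ch. 4, Lemma 4.4] -/
theorem secondFundamentalForm_translate {Φ : E' → E} (hf : ∀ y : U, (f y : E) = Φ y)
    {ν : NormalField 𝓘(ℝ, E) f} {ν' : NormalField 𝓘(ℝ, E) f'} {N : E' → E} (hν : ∀ y : U, ν y = N y)
    (hν' : ∀ y : U, ν' y = N y) {y : U} (hΦ : DifferentiableAt ℝ Φ y) (hN : DifferentiableAt ℝ N y)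
    (hGd : DifferentiableAt ℝ G (f y)) :
    g.secondFundamentalForm 𝓘(ℝ, E') f' ν' y = g.secondFundamentalForm 𝓘(ℝ, E') f ν y := by
  have hrep : ∀ z : U, (f' z : E) = (fun z : E' ↦ Φ z + w) z := fun z ↦ by simp only [hf', hf]
  have hGd' : DifferentiableAt ℝ G (f' y) := by
    rw [show ((f' y : V) : E) = (f y : E) + w from hf' y]
    exact (differentiableAt_iff_of_forall_add_eq hGw _).2 hGd
  refine LinearMap.ext₂ fun v v' ↦ ?_
  rw [secondFundamentalForm_eq_of_repr hG hrep hν' (hΦ.add_const w) hN hGd' v v',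
    secondFundamentalForm_eq_of_repr hG hf hν hΦ hN hGd v v', fderiv_add_const]
  have hx : ((f' y : V) : E) = (f y : E) + w := hf' y
  have hval : (g.val (f' y) : E →L[ℝ] E →L[ℝ] ℝ) = g.val (f y) := by rw [hG, hG, hx, hGw]
  have hΓ : (christoffel g G (f' y) (N y) (fderiv ℝ Φ y v) : E) =
      christoffel g G (f y) (N y) (fderiv ℝ Φ y v) := christoffel_eq_of_add_eq hG hGw hx _ _
  rw [hΓ]
  exact congrFun (congrArg DFunLike.coe (congrFun (congrArg DFunLike.coe hval) _)) _

end SecondFundamentalForm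

end OpensChart

end Literature.Geometry.Lorentzian

end
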